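import Mathlib.RingTheory.PowerSeries.Expand
import Literature.NumberTheory.EllipticCurves.KleinJIntegralQExpansion
import HarnessLib

/-!
# `q`-series absolutely convergent on the unit disc: evaluation homomorphisms, the `q`-expansion
# principle, and a triangular lemma (tools for Cox, *Primes of the form x² + ny²*, Thm. 11.18)

Topic `NumberTheory/EllipticCurves` (level-one modular forms).  Small, general-purpose
infrastructure for comparing *formal* `q`-expansions with *values* of modular functions on `ℍ`,
used to prove the arithmetic of the modular equation `Φ_p` (integrality of its coefficients and
Kronecker's congruence, Cox §11.C Thm. 11.18 (i), (v)) from the integrality of the `q`-expansion of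
`j` (`KleinJIntegralQExpansion.lean`).  Everything is proved.

* `discSeries : Subring ℂ⟦X⟧` — the series `Σ aₙ Xⁿ` with `Σ ‖aₙ wⁿ‖ < ∞` for all `‖w‖ < 1`
  (closed under products by the Cauchy product); it contains polynomials, `formalXJ`
  (`map_formalXJ_mem_discSeries`), and is stable under Mathlib's `rescale a` (`‖a‖ ≤ 1`) and
  `expand d` (`rescale_mem_discSeries`, `expand_mem_discSeries`).
* `evalDisc w hw : discSeries →+* ℂ`, `F ↦ Σ aₙ wⁿ` for `‖w‖ < 1` — a **ring homomorphism**
  (`tsum_mul_tsum_eq_tsum_sum_antidiagonal_of_summable_norm`), with `evalDisc_X`, `evalDisc_C`,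
  `evalDisc_rescale` (`= evalDisc (a w)`), `evalDisc_expand` (`= evalDisc (w^d)`) and
  `evalDisc_qParam_formalXJ : evalDisc q(τ) formalXJ = q(τ) j(τ)` (Cox Thm. 11.8).
* `discSeries_eq_of_evalDisc_qParam_eq`, `polynomial_discSeries_eq_of_map_evalDisc_qParam_eq` — the
  **`q`-expansion principle**: series (or polynomials over `discSeries`) with equal values at all
  `q = e^{2πiτ/h}`, `τ ∈ ℍ`, are equal (from `qSeries_coeff_unique_of_upperHalfPlane`).
* `mem_of_coeff_sum_mul_pow_mem` — the **triangular lemma** behind Hasse's `q`-expansion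
  principle (Cox, proof of Thm. 11.18(i) and Exercise 11.12): if `W ∈ S⟦X⟧` is the image of an
  integer series with constant term `1` (think `W = q·j`) and all coefficients of
  `Σ_{i ≤ N} cᵢ Wⁱ X^{d(N−i)}` lie in an additive subgroup `G ⊆ S`, then all `cᵢ ∈ G` — applied
  later with `G = ℤ[ζ_p] ⊂ ℂ` (integrality) and `G = 0` in `ℤ[ζ_p]/(1 − ζ_p)` (Kronecker).

## Mathlib / tree search

Mathlib (pin of the tree) has `PowerSeries.rescale`, `PowerSeries.expand` (with `coeff_expand`,
`map_expand`, `MvPowerSeries.map_frobenius_expand`) and the Cauchy-product `tsum` lemmas, but no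
bundled "evaluate a complex power series inside its disc of convergence" homomorphism on a subring
(`lean search` for `evalDisc`, `HasFPowerSeriesOnBall.ringHom`: nothing); the tree has the
ultrametric analogue `evalSeries` (`TateSeriesFormal.lean`, integer coefficients, `‖·‖ ≤ 1`
trivially) and the `ℂ`-specific product lemma `tsum_coeff_mul_pow_mul`
(`BSDGoldfeldEulerProduct.lean`), both for `ℤ⟦X⟧` only.

## References

* D. A. Cox, *Primes of the form x² + ny²*, 2nd ed., Wiley 2013, §11.A Thm. 11.8, §11.B
  Lemma 11.10, §11.C proof of Thm. 11.18 (i), (v) and Exercise 11.12 (Hasse's `q`-expansion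
  principle). [Cox2013]
-/

noncomputable section

open Filter Topology Complex PowerSeries
open UpperHalfPlane hiding I
open scoped Real

namespace Literature.NumberTheory.EllipticCurves

/-! ### The subring of series converging absolutely on the open unit disc -/

/-- The subring `𝒮 ⊂ ℂ⟦X⟧` of formal power series `Σ aₙ Xⁿ` with `Σ ‖aₙ wⁿ‖ < ∞` for every
`‖w‖ < 1` (radius of convergence `≥ 1`); it contains the `q`-expansions of modular forms and of
`q·j`, and is the domain of the evaluation homomorphisms `evalDisc w`. [folklore] -/
def discSeries : Subring (PowerSeries ℂ) where
  carrier := {F | ∀ w : ℂ, ‖w‖ < 1 → Summable fun n ↦ ‖coeff n F * w ^ n‖}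
  mul_mem' {F G} hF hG w hw := by
    have h := summable_norm_sum_mul_antidiagonal_of_summable_norm (hF w hw) (hG w hw)
    refine h.of_nonneg_of_le (fun _ ↦ norm_nonneg _) fun n ↦ le_of_eq ?_
    congr 1
    rw [coeff_mul, Finset.sum_mul]
    refine Finset.sum_congr rfl fun kl hkl ↦ ?_
    rw [← Finset.mem_antidiagonal.mp hkl, pow_add]
    ring
  one_mem' w hw := by
    refine summable_of_ne_finset_zero (s := {0}) fun n hn ↦ ?_
    rw [Finset.mem_singleton] at hn
    simp [coeff_one, hn]
  add_mem' {F G} hF hG w hw := by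
    refine ((hF w hw).add (hG w hw)).of_nonneg_of_le (fun _ ↦ norm_nonneg _) fun n ↦ ?_
    rw [map_add, add_mul]
    exact norm_add_le _ _
  zero_mem' w hw := by simp [summable_zero]
  neg_mem' {F} hF w hw := by simpa using hF w hw

/-- Membership in `discSeries`. [folklore] -/
lemma mem_discSeries_iff {F : PowerSeries ℂ} :
    F ∈ discSeries ↔ ∀ w : ℂ, ‖w‖ < 1 → Summable fun n ↦ ‖coeff n F * w ^ n‖ := Iff.rfl

/-- **Evaluation at a point of the unit disc** is a ring homomorphism `𝒮 → ℂ`,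
`F ↦ Σ aₙ wⁿ` (Cauchy product of absolutely convergent series). [folklore] -/
def evalDisc (w : ℂ) (hw : ‖w‖ < 1) : discSeries →+* ℂ where
  toFun F := ∑' n, coeff n (F : PowerSeries ℂ) * w ^ n
  map_one' := by
    rw [tsum_eq_single 0 fun n hn ↦ by simp [coeff_one, hn]]
    simp
  map_mul' F G := by
    rw [Subring.coe_mul, tsum_mul_tsum_eq_tsum_sum_antidiagonal_of_summable_norm (F.2 w hw) (G.2 w hw)]
    refine tsum_congr fun n ↦ ?_
    rw [coeff_mul, Finset.sum_mul]
    refine Finset.sum_congr rfl fun kl hkl ↦ ?_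
    rw [← Finset.mem_antidiagonal.mp hkl, pow_add]
    ring
  map_zero' := by simp
  map_add' F G := by
    rw [Subring.coe_add]
    simp only [map_add, add_mul]
    exact (F.2 w hw).of_norm.tsum_add (G.2 w hw).of_norm

/-- Unfolding of `evalDisc`. [folklore] -/
lemma evalDisc_apply {w : ℂ} (hw : ‖w‖ < 1) (F : discSeries) :
    evalDisc w hw F = ∑' n, coeff n (F : PowerSeries ℂ) * w ^ n := rfl

/-- `Σ aₙ wⁿ` converges to `evalDisc w F`. [folklore] -/
lemma hasSum_evalDisc {w : ℂ} (hw : ‖w‖ < 1) (F : discSeries) :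
    HasSum (fun n ↦ coeff n (F : PowerSeries ℂ) * w ^ n) (evalDisc w hw F) :=
  (F.2 w hw).of_norm.hasSum

/-- A power series with finite support (a polynomial) lies in `𝒮`. [folklore] -/
lemma coe_polynomial_mem_discSeries (P : Polynomial ℂ) : (P : PowerSeries ℂ) ∈ discSeries := by
  intro w _
  refine summable_of_ne_finset_zero (s := P.support) fun n hn ↦ ?_
  rw [Polynomial.coeff_coe, Polynomial.notMem_support_iff.mp hn]
  simp

/-- `X ∈ 𝒮`. [folklore] -/
lemma X_mem_discSeries : (X : PowerSeries ℂ) ∈ discSeries := by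
  simpa using coe_polynomial_mem_discSeries Polynomial.X

/-- `C a ∈ 𝒮`. [folklore] -/
lemma C_mem_discSeries (a : ℂ) : (C a : PowerSeries ℂ) ∈ discSeries := by
  simpa using coe_polynomial_mem_discSeries (Polynomial.C a)

/-- `evalDisc w X = w`. [folklore] -/
@[simp] lemma evalDisc_X {w : ℂ} (hw : ‖w‖ < 1) : evalDisc w hw ⟨X, X_mem_discSeries⟩ = w := by
  rw [evalDisc_apply, tsum_eq_single 1 fun n hn ↦ by simp [coeff_X, hn]]
  simp [coeff_X]

/-- `evalDisc w (C a) = a`. [folklore] -/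
@[simp] lemma evalDisc_C {w : ℂ} (hw : ‖w‖ < 1) (a : ℂ) : evalDisc w hw ⟨C a, C_mem_discSeries a⟩ = a := by
  rw [evalDisc_apply, tsum_eq_single 0 fun n hn ↦ by simp [coeff_C, hn]]
  simp

/-- `evalDisc w (X^k) = w^k`. [folklore] -/
lemma evalDisc_X_pow {w : ℂ} (hw : ‖w‖ < 1) (k : ℕ) :
    evalDisc w hw ⟨X ^ k, pow_mem X_mem_discSeries k⟩ = w ^ k := by
  have : (⟨X ^ k, pow_mem X_mem_discSeries k⟩ : discSeries) = ⟨X, X_mem_discSeries⟩ ^ k := rfl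
  rw [this, map_pow, evalDisc_X]

/-- **The `q`-expansion of `q·j` lies in `𝒮`** (`summable_norm_formalXJ_mul_pow`).
[cite: Cox2013, §11.A Thm. 11.8] -/
lemma map_formalXJ_mem_discSeries : formalXJ.map (Int.castRingHom ℂ) ∈ discSeries := by
  intro w hw
  simpa only [coeff_map, Int.coe_castRingHom] using summable_norm_formalXJ_mul_pow hw

/-- `evalDisc q(τ) (formalXJ) = q(τ) j(τ)` (Cox Thm. 11.8). [cite: Cox2013, §11.A Thm. 11.8] -/
lemma evalDisc_qParam_formalXJ (τ : ℍ) :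
    evalDisc (Function.Periodic.qParam 1 τ) (ModularForms.norm_qParam_one_lt_one τ)
      ⟨formalXJ.map (Int.castRingHom ℂ), map_formalXJ_mem_discSeries⟩ =
      Function.Periodic.qParam 1 τ * ModularForms.kleinJ τ := by
  rw [evalDisc_apply, ← (hasSum_formalXJ τ).tsum_eq]
  simp only [coeff_map, Int.coe_castRingHom]

/-! ### Rescaling and expanding -/

/-- `𝒮` is stable under `rescale a` for `‖a‖ ≤ 1` (`Σ aⁿ cₙ Xⁿ`). [folklore] -/
lemma rescale_mem_discSeries {F : PowerSeries ℂ} (hF : F ∈ discSeries) {a : ℂ} (ha : ‖a‖ ≤ 1) :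
    rescale a F ∈ discSeries := by
  intro w hw
  refine (hF w hw).of_nonneg_of_le (fun _ ↦ norm_nonneg _) fun n ↦ ?_
  rw [coeff_rescale, mul_assoc, norm_mul, norm_pow]
  exact mul_le_of_le_one_left (norm_nonneg _) (pow_le_one₀ (norm_nonneg _) ha)

/-- `‖a w‖ < 1` for `‖a‖ ≤ 1`, `‖w‖ < 1`. [folklore] -/
lemma norm_mul_lt_one_of_norm_le_one {a w : ℂ} (ha : ‖a‖ ≤ 1) (hw : ‖w‖ < 1) : ‖a * w‖ < 1 := by
  rw [norm_mul]; exact lt_of_le_of_lt (mul_le_of_le_one_left (norm_nonneg _) ha) hw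

/-- `evalDisc w (rescale a F) = evalDisc (a w) F`. [folklore] -/
lemma evalDisc_rescale {F : PowerSeries ℂ} (hF : F ∈ discSeries) {a : ℂ} (ha : ‖a‖ ≤ 1) {w : ℂ}
    (hw : ‖w‖ < 1) :
    evalDisc w hw ⟨rescale a F, rescale_mem_discSeries hF ha⟩ =
      evalDisc (a * w) (norm_mul_lt_one_of_norm_le_one ha hw) ⟨F, hF⟩ := by
  simp only [evalDisc_apply, coeff_rescale, mul_pow]
  exact tsum_congr fun n ↦ by ring

/-- `‖w^d‖ < 1` for `‖w‖ < 1`, `d ≠ 0`. [folklore] -/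
lemma norm_pow_lt_one_of_ne_zero {w : ℂ} (hw : ‖w‖ < 1) {d : ℕ} (hd : d ≠ 0) : ‖w ^ d‖ < 1 := by
  rw [norm_pow]; exact pow_lt_one₀ (norm_nonneg _) hw hd

/-- `𝒮` is stable under `expand d` (`Σ cₙ X^{dn}`). [folklore] -/
lemma expand_mem_discSeries {F : PowerSeries ℂ} (hF : F ∈ discSeries) (d : ℕ) (hd : d ≠ 0) :
    expand d hd F ∈ discSeries := by
  intro w hw
  have hinj : Function.Injective (fun n : ℕ ↦ d * n) := mul_right_injective₀ hd
  rw [← hinj.summable_iff (f := fun m ↦ ‖coeff m (expand d hd F) * w ^ m‖)]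
  · simp only [Function.comp_def, coeff_expand_mul, pow_mul]
    exact hF (w ^ d) (norm_pow_lt_one_of_ne_zero hw hd)
  · intro m hm
    rw [Set.mem_range, not_exists] at hm
    rw [coeff_expand_of_not_dvd _ _ _ fun ⟨n, hn⟩ ↦ hm n hn.symm]
    simp

/-- `evalDisc w (expand d F) = evalDisc (w^d) F`. [folklore] -/
lemma evalDisc_expand {F : PowerSeries ℂ} (hF : F ∈ discSeries) {d : ℕ} (hd : d ≠ 0) {w : ℂ} (hw : ‖w‖ < 1) :
    evalDisc w hw ⟨expand d hd F, expand_mem_discSeries hF d hd⟩ =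
      evalDisc (w ^ d) (norm_pow_lt_one_of_ne_zero hw hd) ⟨F, hF⟩ := by
  simp only [evalDisc_apply]
  have hinj : Function.Injective (fun n : ℕ ↦ d * n) := mul_right_injective₀ hd
  rw [← hinj.tsum_eq]
  · simp only [coeff_expand_mul, pow_mul]
  · intro m hm
    by_contra hm'
    rw [Set.mem_range, not_exists] at hm'
    exact hm (by
      show coeff m (expand d hd F) * w ^ m = 0
      rw [coeff_expand_of_not_dvd _ _ _ fun ⟨n, hn⟩ ↦ hm' n hn.symm, zero_mul])

/-! ### The `q`-expansion principle for `𝒮` -/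

/-- **Two series of `𝒮` with the same values at all `q(τ) = e^{2πiτ/h}`, `τ ∈ ℍ`, are equal**
(the elementary `q`-expansion principle, via `qSeries_coeff_unique_of_upperHalfPlane`).
[folklore] -/
theorem discSeries_eq_of_evalDisc_qParam_eq {h : ℝ} (hh : 0 < h) {F G : discSeries}
    (hFG : ∀ τ : ℍ, evalDisc (Function.Periodic.qParam h τ) (Function.Periodic.norm_qParam_lt_one hh τ.im_pos) F =
      evalDisc (Function.Periodic.qParam h τ) (Function.Periodic.norm_qParam_lt_one hh τ.im_pos) G) :
    F = G := by
  have := qSeries_coeff_unique_of_upperHalfPlane hh (c := fun n ↦ coeff n (F : PowerSeries ℂ))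
    (c' := fun n ↦ coeff n (G : PowerSeries ℂ))
    (f := fun τ ↦ evalDisc (Function.Periodic.qParam h τ) (Function.Periodic.norm_qParam_lt_one hh τ.im_pos) F)
    (fun τ ↦ hasSum_evalDisc _ F) (fun τ ↦ by rw [hFG τ]; exact hasSum_evalDisc _ G)
  exact Subtype.ext (PowerSeries.ext fun n ↦ congr_fun this n)

/-- The `q`-expansion principle for polynomials with coefficients in `𝒮`. [folklore] -/
theorem polynomial_discSeries_eq_of_map_evalDisc_qParam_eq {h : ℝ} (hh : 0 < h)
    {P Q : Polynomial discSeries}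
    (hPQ : ∀ τ : ℍ, P.map (evalDisc (Function.Periodic.qParam h τ) (Function.Periodic.norm_qParam_lt_one hh τ.im_pos)) =
      Q.map (evalDisc (Function.Periodic.qParam h τ) (Function.Periodic.norm_qParam_lt_one hh τ.im_pos))) :
    P = Q := by
  refine Polynomial.ext fun m ↦ discSeries_eq_of_evalDisc_qParam_eq hh fun τ ↦ ?_
  have := congr_arg (fun R ↦ Polynomial.coeff R m) (hPQ τ)
  simpa only [Polynomial.coeff_map] using this

/-! ### A triangular lemma: reading off coefficients of an expansion in powers of a unit series -/

/-- **Triangular lemma.**  Let `W = 1 + ⋯ ∈ S⟦X⟧` be the image of an integer series with constant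
term `1`, `d ≥ 1`, and `c₀, …, c_N ∈ S`.  If every coefficient of `Σ_{i ≤ N} cᵢ Wⁱ X^{d(N−i)}`
lies in an additive subgroup `G`, then every `cᵢ ∈ G` (the terms have distinct orders `d(N−i)`
with unit leading coefficients).  This is the passage "from the coefficients of the `q`-expansion
to the coefficients of the polynomial `A(X)`" in Cox's proof of Thm. 11.18(i),(v) (Hasse's
`q`-expansion principle, Exercise 11.12), for `W = q·j`. [cite: Cox2013, §11.C proof of Thm. 11.18(i)] -/
theorem mem_of_coeff_sum_mul_pow_mem {S : Type*} [CommRing S] (G : AddSubgroup S) {w : PowerSeries ℤ}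
    (hw : constantCoeff w = 1) {d : ℕ} (hd : d ≠ 0) (c : ℕ → S) :
    ∀ N : ℕ, (∀ n, coeff n (∑ i ∈ Finset.range (N + 1),
      C (c i) * (w.map (Int.castRingHom S)) ^ i * X ^ (d * (N - i))) ∈ G) → ∀ i ≤ N, c i ∈ G := by
  set W := w.map (Int.castRingHom S) with hW
  -- coefficients of `a • Wⁱ` lie in `G` as soon as `a ∈ G`
  have hWint : ∀ (i n : ℕ) (a : S), a ∈ G → coeff n (C a * W ^ i) ∈ G := by
    intro i n a ha
    rw [← map_pow, coeff_C_mul, coeff_map, Int.coe_castRingHom, mul_comm, ← zsmul_eq_mul]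
    exact G.zsmul_mem ha _
  intro N
  induction N with
  | zero =>
    intro h i hi
    obtain rfl : i = 0 := Nat.le_zero.mp hi
    have h0 := h 0
    simp only [zero_add, Finset.range_one, Finset.sum_singleton, Nat.sub_self, mul_zero, pow_zero,
      mul_one] at h0
    simpa using h0
  | succ N ih =>
    intro h
    -- split off the term `i = N + 1`
    have hsplit : ∑ i ∈ Finset.range (N + 1 + 1), C (c i) * W ^ i * X ^ (d * (N + 1 - i)) =
        X ^ d * ∑ i ∈ Finset.range (N + 1), C (c i) * W ^ i * X ^ (d * (N - i)) +
          C (c (N + 1)) * W ^ (N + 1) := by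
      rw [Finset.sum_range_succ, Nat.sub_self, mul_zero, pow_zero, mul_one, Finset.mul_sum]
      congr 1
      refine Finset.sum_congr rfl fun i hi ↦ ?_
      have hi' : i ≤ N := Nat.lt_succ_iff.mp (Finset.mem_range.mp hi)
      rw [show N + 1 - i = (N - i) + 1 by omega, mul_add, mul_one, pow_add]
      ring
    -- the constant coefficient gives `π (N+1) ∈ G`
    have htop : c (N + 1) ∈ G := by
      have h0 := h 0
      rw [hsplit, map_add, coeff_zero_eq_constantCoeff_apply (φ := X ^ d * _), map_mul, map_pow,
        constantCoeff_X, zero_pow hd, zero_mul, zero_add, coeff_C_mul, ← map_pow, coeff_map,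
        coeff_zero_eq_constantCoeff_apply, map_pow, hw, one_pow] at h0
      simpa using h0
    -- the remaining coefficients give the hypothesis for `N`
    have hrest : ∀ n, coeff n (∑ i ∈ Finset.range (N + 1), C (c i) * W ^ i * X ^ (d * (N - i))) ∈ G := by
      intro n
      have hn := h (n + d)
      rw [hsplit, map_add, coeff_X_pow_mul] at hn
      have := G.sub_mem hn (hWint (N + 1) (n + d) _ htop)
      simpa using this
    intro i hi
    rcases Nat.lt_or_eq_of_le hi with hi' | rfl
    · exact ih hrest i (Nat.lt_succ_iff.mp hi')
    · exact htop

end Literature.NumberTheory.EllipticCurves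

end
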